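import Summits.QuantumFields.Balaban3D.Proofs.InputsAC
import Literature.MathematicalPhysics.QuantumFieldTheory.Balaban1983to89.B10Eq35Norm
import HarnessLib

/-!
# `AlphaInputsT3ACNorm35LogZTRowsOfLeaves` — THE (α) ROWS `norm35` (G3D-04) AND `logZT` (G3D-05) ARE DOORS TO TWO SCALAR LEAVES: the `Nonempty (…Model)` rows of
# `StepAlphaV3AC`∕`StepDataV3CoreAC` hold as soon as the leaf (35)_k `Norm35 P C` resp. the extensivity `|log Z^{(k)}(T₁^{(k)},1)| ≤ C·|T₁^{(k)}|` hold (0-dimensional model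
# instances), and — at the lane's carrier — as soon as the carrier's OWN (63)-representation `(dimT, QT, JT)` has Loewner bounds and volume counts (the intended model)

Cell `ym3-torus` (HUMAN RULING D-0037, YM ladder rung R3), width seat `ym-ust-19936-w8` (g15), LOCATE-FIRST brick «norm35 ∕ logZT» (★★OWNER ym3-torus-plan g35, 2026-08-30T11:21:35Z)
on the registered row (O‴χₛ) `stub_selXsV4DataRows` of crux `HistoryTailL` (stmt-QuantumFields-19936, registry `Cruxes/HistoryTailL/Lines/unbundled_v6.lean`).  `--supports
stmt-QuantumFields-19936` (helper).  THEOREMS ONLY (def-free), sorry-free, standard axioms.  Count-neutral: (α) data rows landed 0∕23 before and after this file.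

WHERE THE TWO ROWS SIT.  (O‴χₛ) ⟶ `AlphaInputsT3AC.DataRowsT3XsChiSel F 𝔠 γ hγ hγ1 K Ut` (`…v3RecordSelXsChi` :163) ⟶ `∃ 𝔖 𝔄, ∀ k < K, StepDataV3ChiAC … k` ⟶ its core
`StepDataV3CoreAC` (`…v3DataSchemaChi` :121∕:123) = the lane's `StepAlphaV3AC` rows (`…v3Lane` :115∕:117; `PkgCoreRows`: `(p.runRows.steps k hk).norm35∕.logZT`):
* `norm35 : Norm35StepAsCited (piecesAC 𝔠.lane X 𝔖 k) 𝔠.c35 𝔠.a35 𝔠.cv 𝔠.cJ35` := `∀ h, Nonempty (B10Eq35Norm.Norm35Model P c a cv cJ h)` (binder G3D-04, bill #12);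
* `logZT : LogZTExtensiveAsCited (piecesAC 𝔠.lane X 𝔖 k) 𝔠.cT 𝔠.aT 𝔠.cn 𝔠.cJT` := `Nonempty (Binders.LogZTModel P c a cn cJ)` (binder G3D-05, bill #13).
Their ONLY consumers read them back as scalars: `AlphaAdaptersAC.norm35_piecesAC` (→ leaf C8 `Norm35 P C₅`, `C₅ = cv·u + cJ`, `u := (log 2π + max(|log c|,|log a|))∕2`) and
`AlphaAdaptersAC.logZT_le_piecesAC` (→ B20 `|P.logZT| ≤ z·|T₁^{(k)}|`, `z = cn·u + cJ`) — both via `B10Eq35Norm.norm35_of_model` ∕ `Binders.LogZTModel.logZT_le`.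

WHAT THIS FILE PROVES (kernel; [folklore] linear algebra over zero variables + the structures' constructors).
* §1 (any `B10.TowerRun`, any `StepPieces`): ★`logZTExtensiveAsCited_of_abs_logZT_le` — `|P.logZT| ≤ cJ·T.sites k` (+ `0 ≤ cn·T.sites k`) ⇒ `LogZTExtensiveAsCited P c a cn cJ` for
  EVERY `c, a` (model with NO Gaussian variables, `J := P.logZT`); ★`norm35StepAsCited_of_norm35` — the leaf `Norm35 P cJ` (+ `0 ≤ cv`) ⇒ `Norm35StepAsCited P c a cv cJ` for EVERY
  `c, a` (empty core, no extra coordinates, `J₁ := P.logZ1 h`, `J₂ := P.logZT`).  With the tree's converses (`0 < c`): ★`exists_logZTExtensiveAsCited_iff` ∕ ★`exists_norm35StepAsCited_iff`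
  — AS BINDER CLASSES the two `Nonempty (…Model)` rows ARE the two scalar leaves (constants inflate by `cv·u` ∕ `cn·u` one way, not at all the other).  So the Loewner-bound fields of
  the models constrain nothing by themselves: the rows' content is exactly (35)_k `|log Z^{(k)}(B(Λ_{k+1}),1) − log Z^{(k)}(T₁^{(k)},1)| ≤ C|Z_k|` and (65)_T `|log Z^{(k)}(T₁^{(k)},1)| ≤ C|T₁^{(k)}|`.
* §2 (the lane's AC carrier `piecesAC 𝔎 X 𝔖 k`): `piecesAC_logZT_eq` ∕ `piecesAC_logZ1_eq` (`rfl`: the pieces ARE the carrier's (63)-representation `JT + gaussLog QT`, `J1 h + gaussLog (Q1 h)`);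
  ★★`logZTExtensiveAsCited_piecesAC_of_loewner` — THE INTENDED MODEL: Loewner bounds `c·1 ⪯ (𝔖 k).QT ⪯ a·1`, `dimT ≤ cn·|T₁^{(k)}|`, `|JT| ≤ cJ·|T₁^{(k)}|` ⇒ the `logZT` row, with
  `dim := dimT`, `Q := QT`, `J := JT`, `logZT_eq := rfl`; the scalar readings ★`logZTExtensiveAsCited_piecesAC_of_abs_le` ∕ ★`norm35StepAsCited_piecesAC_of_abs_le` in the carrier's
  letters; and what the rows give back (`abs_logZT_piecesAC_le_of_row`, `norm35_piecesAC_of_row'`).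
LOCATED (reading level, for the bill's DEFINER B0): both numbers are FLAT-BACKGROUND objects (`U = 1`): `Z^{(k)}(T₁^{(k)}, 1)` and `Z^{(k)}(B(Λ_{k+1}), 1)` — constrained Gaussian
normalisations of the unit-lattice fluctuation form at the trivial configuration ([Balaban1985UV3] (22) p. 261, (61)–(63) pp. 271–272; not defined in print, cell GAPS G-B10-03; the
tree's vocabulary for the definition is `Beta.ConstrainedGaussian.{kkt, logZ, reduced, logZred}` + `Beta.ConstraintElimination.logZ_eq_logZred_sub_log`).  Hence the curved
operator layer of [Balaban1985BackgroundPropagators] (WANTED №g25-1) is NOT on these two rows' path; what they need of [B9] is Thm 3.11 ∕ (3.155)–(3.156) AT `U = 1` (lower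
Loewner bound), `‖Δ(1)‖` (upper), the common-core block structure of `B10Eq35Norm` §2–§4, and two volume counts.
HONEST SCOPE.  Doors and bookkeeping; NO estimate of [Balaban1985UV3] is proved; the rows `norm35`∕`logZT` are NOT discharged for Bałaban's witness (no witness `𝔖_Bal` exists in the
tree); (O‴χₛ), EX, `HistoryTailL` (19936), 19200, 20520, `YM3TorusSU2` NOT proved; rung R3 = SU(2) YM₃ on T³ — NOT d = 4, NOT infinite volume, NOT a mass gap, NOT Clay.
References: T. Bałaban, Commun. Math. Phys. 102 (1985) 255–275 [Balaban1985UV3] ((35) p. 265, (61)–(63) pp. 271–272, (65) p. 273); Commun. Math. Phys. 99 (1985) 389–434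
[Balaban1985BackgroundPropagators] (Thm 3.11 p. 416, (3.155)–(3.156) pp. 427–428).
-/

set_option autoImplicit false

noncomputable section

open MeasureTheory
open scoped Matrix

namespace Summit.QuantumFields.YangMills.Theorems.AlphaInputsT3ACNorm35LogZTRowsOfLeaves

open Literature.MathematicalPhysics.QuantumFieldTheory.Balaban1983to89
open Literature.MathematicalPhysics.QuantumFieldTheory.Balaban1983to89.B10
open Literature.MathematicalPhysics.QuantumFieldTheory.Balaban1983to89.B10SectAGathering
open Literature.MathematicalPhysics.QuantumFieldTheory.Balaban1983to89.B10Eq35Norm (Norm35Model norm35_of_model)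
open Literature.MathematicalPhysics.QuantumFieldTheory.Balaban1985CMP102
open Literature.MathematicalPhysics.QuantumFieldTheory.Balaban1985CMP102.Setting
open Literature.MathematicalPhysics.QuantumFieldTheory.Balaban1985CMP102.Binders (Norm35StepAsCited LogZTExtensiveAsCited LogZTModel)
open Summit.QuantumFields.Balaban3D.Carriers
open Summit.QuantumFields.Balaban3D.Proofs.ScalesArithmetic (sites_nonneg)
open Summit.QuantumFields.Balaban3D.Proofs.Inputs
open Summit.QuantumFields.Balaban3D.Proofs.TowerAC
open Summit.QuantumFields.Balaban3D.Proofs.SeriesAC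
open Summit.QuantumFields.Balaban3D.Proofs.StandardAC
open Summit.QuantumFields.Balaban3D.Proofs.InputsAC

/-! ## §0 Folklore: matrices and Gaussian integrals over ZERO variables -/

/-- A real matrix over an empty index type is positive semidefinite (it is `0`). [folklore] -/
private theorem posSemidef_of_isEmpty {ι : Type} [Fintype ι] [DecidableEq ι] [IsEmpty ι] (M : Matrix ι ι ℝ) : M.PosSemidef := by
  rw [Subsingleton.elim M 0]
  exact Matrix.PosSemidef.zero

/-- `log ∫_{ℝ⁰} e^{−½⟨v,Qv⟩} dv = log 1 = 0`. [folklore] -/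
private theorem log_gaussian_of_isEmpty {ι : Type} [Fintype ι] [IsEmpty ι] (Q : Matrix ι ι ℝ) :
    Real.log (∫ v : ι → ℝ, Real.exp (-(1 / 2 : ℝ) * (v ⬝ᵥ Q *ᵥ v))) = 0 := by
  rw [MeasureTheory.volume_pi, Measure.pi_of_empty (x := isEmptyElim), integral_dirac]
  have : (isEmptyElim : ι → ℝ) ⬝ᵥ Q *ᵥ isEmptyElim = 0 := by simp [dotProduct]
  rw [this, mul_zero, Real.exp_zero, Real.log_one]

/-! ## §1 The two binders are the two scalar leaves (any tower, any step pieces) -/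

section Generic

variable {T : TowerRun} {k : ℕ} {P : StepPieces T k}

/-- ★ **G3D-05 ⟸ EXTENSIVITY OF `log Z^{(k)}(T₁^{(k)}, 1)`** (for EVERY pair of form bounds `c, a`): if `|P.logZT| ≤ cJ·|T₁^{(k)}|` and `0 ≤ cn·|T₁^{(k)}|`, the model
data of `LogZTExtensiveAsCited P c a cn cJ` EXIST — no Gaussian variables, `J := P.logZT` (`log ∫_{ℝ⁰} 1 = 0`). [cite: Balaban1985UV3, (62) p.271 + (65) p.273] -/
theorem logZTExtensiveAsCited_of_abs_logZT_le {c a cn cJ : ℝ} (hcn : 0 ≤ cn * T.sites k) (h : |P.logZT| ≤ cJ * T.sites k) :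
    LogZTExtensiveAsCited P c a cn cJ :=
  ⟨{ dim := 0, Q := 0, J := P.logZT
     lower := posSemidef_of_isEmpty _
     upper := posSemidef_of_isEmpty _
     logZT_eq := by rw [log_gaussian_of_isEmpty, add_zero]
     count_le := by simpa using hcn
     jac_le := h }⟩

/-- ★ **G3D-04 ⟸ THE LEAF (35)_k** (for EVERY pair of form bounds `c, a`): if `Norm35 P cJ` (`∀ h, |log Z^{(k)}(B(Λ_{k+1}),1) − log Z^{(k)}(T₁^{(k)},1)| ≤ cJ·|Z_k|`) and
`0 ≤ cv`, the model data of `Norm35StepAsCited P c a cv cJ` EXIST at every history — empty common core, no extra coordinates, `J₁ := P.logZ1 h`, `J₂ := P.logZT`.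
[cite: Balaban1985UV3, (35) p.265 + (61)–(62) p.271] -/
theorem norm35StepAsCited_of_norm35 {c a cv cJ : ℝ} (hcv : 0 ≤ cv) (h : Norm35 P cJ) : Norm35StepAsCited P c a cv cJ := fun hh =>
  ⟨{ r := 0, s := 0, t := 0, K := 0, B₁ := 0, D₁ := 0, B₂ := 0, D₂ := 0, J₁ := P.logZ1 hh, J₂ := P.logZT
     lower₁ := posSemidef_of_isEmpty _
     upper₁ := posSemidef_of_isEmpty _
     lower₂ := posSemidef_of_isEmpty _
     upper₂ := posSemidef_of_isEmpty _
     logZ1_eq := by rw [log_gaussian_of_isEmpty, add_zero]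
     logZT_eq := by rw [log_gaussian_of_isEmpty, add_zero]
     count_le := by simpa using mul_nonneg hcv (P.Zvol_nonneg hh)
     jac_le := h hh }⟩

/-- ★ **AS BINDER CLASSES, G3D-05 IS EXTENSIVITY**: for `0 < c` and `0 ≤ cn·|T₁^{(k)}|`, `(∃ cJ, LogZTExtensiveAsCited P c a cn cJ) ↔ ∃ C, |P.logZT| ≤ C·|T₁^{(k)}|`
(→ by `Binders.LogZTExtensiveAsCited.logZT_le` with `C = cn·(log 2π + max(|log c|,|log a|))∕2 + cJ`; ← by the 0-dimensional model). [cite: Balaban1985UV3, (65) p.273] -/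
theorem exists_logZTExtensiveAsCited_iff {c a cn : ℝ} (hc : 0 < c) (hcn : 0 ≤ cn * T.sites k) :
    (∃ cJ : ℝ, LogZTExtensiveAsCited P c a cn cJ) ↔ ∃ C : ℝ, |P.logZT| ≤ C * T.sites k :=
  ⟨fun ⟨_, h⟩ => ⟨_, h.logZT_le hc⟩, fun ⟨C, h⟩ => ⟨C, logZTExtensiveAsCited_of_abs_logZT_le hcn h⟩⟩

/-- ★ **AS BINDER CLASSES, G3D-04 IS THE LEAF (35)_k**: for `0 < c` and `0 ≤ cv`, `(∃ cJ, Norm35StepAsCited P c a cv cJ) ↔ ∃ C, Norm35 P C`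
(→ by `Binders.Norm35StepAsCited.norm35`; ← by the 0-dimensional model). [cite: Balaban1985UV3, (35) p.265] -/
theorem exists_norm35StepAsCited_iff {c a cv : ℝ} (hc : 0 < c) (hcv : 0 ≤ cv) :
    (∃ cJ : ℝ, Norm35StepAsCited P c a cv cJ) ↔ ∃ C : ℝ, Norm35 P C :=
  ⟨fun ⟨_, h⟩ => ⟨_, h.norm35 hc⟩, fun ⟨C, h⟩ => ⟨C, norm35StepAsCited_of_norm35 hcv h⟩⟩

end Generic

/-! ## §2 At the lane's AC carrier: the pieces ARE the carrier's (63)-representation; the intended model; the scalar readings -/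

section Carrier

variable {L : ℕ} (𝔎 : LaneConsts L) {S : Scales L} {G : Type} [GaugeGroup G] [MeasurableSpace G] [HaarData G]
  {V : Type} [NormedAddCommGroup V] [NormedSpace ℂ V]
  (X : ExternalInputsAC S G) (𝔖 : ∀ k, StepSeries S G V (nblkOf S 𝔎.carrier k) k)

/-- `log Z^{(k)}(T₁^{(k)}, 1)` of the lane's AC pieces IS the carrier's (63)-representation `JT + log ∫ e^{−½⟨v, QT v⟩}` (definitional). [cite: Balaban1985UV3, (62)–(63) pp.271–272] -/
theorem piecesAC_logZT_eq (k : ℕ) : (piecesAC 𝔎 X 𝔖 k).logZT = (𝔖 k).JT + StepSeries.gaussLog (𝔖 k).QT := rfl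

/-- `log Z^{(k)}(B(Λ_{k+1}), 1)` of the lane's AC pieces IS `J1 h + log ∫ e^{−½⟨v, Q1 h v⟩}` (definitional). [cite: Balaban1985UV3, (61) p.271 + (63) p.272] -/
theorem piecesAC_logZ1_eq (k : ℕ) (h : Hist S.P (k + 1)) :
    (piecesAC 𝔎 X 𝔖 k).logZ1 h = (𝔖 k).J1 h + StepSeries.gaussLog ((𝔖 k).Q1 h) := rfl

/-- The pieces' `|T₁^{(k)}|` is the scales' `S.sites k` (definitional). [cite: Balaban1985UV3, (62) p.271] -/
theorem towerOfAC_sites_eq (k : ℕ) : (towerOfAC 𝔎 X 𝔖).sites k = S.sites k := rfl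

/-- ★★ **THE INTENDED MODEL OF G3D-05 AT THE CARRIER**: Loewner bounds `c·1 ⪯ QT ⪯ a·1` on the carrier's own precision form of `Z^{(k)}(T₁^{(k)}, 1)` (lower =
[Balaban1985BackgroundPropagators] Thm 3.11 ∕ (3.155)–(3.156) at `U = 1`, upper = boundedness of `Δ(1)`), the variable count `dimT ≤ cn·|T₁^{(k)}|` and the constraint-elimination
constant `|JT| ≤ cJ·|T₁^{(k)}|` give the `logZT` row with `dim := dimT`, `Q := QT`, `J := JT`, `logZT_eq := rfl` — this is what a DEFINER of Bałaban's `𝔖` has to supply for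
the row in its intended reading. [cite: Balaban1985UV3, (62)–(63) pp.271–272; Balaban1985BackgroundPropagators, Thm 3.11 p.416] -/
theorem logZTExtensiveAsCited_piecesAC_of_loewner (k : ℕ) {c a cn cJ : ℝ}
    (hlo : ((𝔖 k).QT - c • (1 : Matrix (Fin (𝔖 k).dimT) (Fin (𝔖 k).dimT) ℝ)).PosSemidef)
    (hhi : (a • (1 : Matrix (Fin (𝔖 k).dimT) (Fin (𝔖 k).dimT) ℝ) - (𝔖 k).QT).PosSemidef)
    (hcount : ((𝔖 k).dimT : ℝ) ≤ cn * S.sites k) (hjac : |(𝔖 k).JT| ≤ cJ * S.sites k) :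
    LogZTExtensiveAsCited (piecesAC 𝔎 X 𝔖 k) c a cn cJ :=
  ⟨{ dim := (𝔖 k).dimT, Q := (𝔖 k).QT, J := (𝔖 k).JT
     lower := hlo
     upper := hhi
     logZT_eq := rfl
     count_le := hcount
     jac_le := hjac }⟩

/-- ★ **THE SCALAR READING OF G3D-05 AT THE CARRIER**: `|JT + log ∫ e^{−½⟨v, QT v⟩}| ≤ cJ·|T₁^{(k)}|` and `0 ≤ cn` ⇒ the `logZT` row (every `c, a`).
[cite: Balaban1985UV3, (62) p.271 + (65) p.273] -/
theorem logZTExtensiveAsCited_piecesAC_of_abs_le (k : ℕ) {c a cn cJ : ℝ} (hcn : 0 ≤ cn)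
    (h : |(𝔖 k).JT + StepSeries.gaussLog (𝔖 k).QT| ≤ cJ * S.sites k) :
    LogZTExtensiveAsCited (piecesAC 𝔎 X 𝔖 k) c a cn cJ :=
  logZTExtensiveAsCited_of_abs_logZT_le (mul_nonneg hcn (sites_nonneg S k)) h

/-- ★ **THE SCALAR READING OF G3D-04 AT THE CARRIER**: (35)_k in the carrier's letters, `∀ h, |(J1 h + log ∫ e^{−½⟨v,Q1 h v⟩}) − (JT + log ∫ e^{−½⟨v,QT v⟩})| ≤ cJ·|Z_k(h)|`,
and `0 ≤ cv` ⇒ the `norm35` row (every `c, a`). [cite: Balaban1985UV3, (35) p.265 + (61)–(62) p.271] -/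
theorem norm35StepAsCited_piecesAC_of_abs_le (k : ℕ) {c a cv cJ : ℝ} (hcv : 0 ≤ cv)
    (h : ∀ hh : Hist S.P (k + 1), |(𝔖 k).J1 hh + StepSeries.gaussLog ((𝔖 k).Q1 hh) - ((𝔖 k).JT + StepSeries.gaussLog (𝔖 k).QT)|
      ≤ cJ * (piecesAC 𝔎 X 𝔖 k).Zvol hh) :
    Norm35StepAsCited (piecesAC 𝔎 X 𝔖 k) c a cv cJ :=
  norm35StepAsCited_of_norm35 hcv h

/-- What the `logZT` row GIVES BACK at the carrier (`0 < c`): `|JT + log ∫ e^{−½⟨v, QT v⟩}| ≤ (cn·(log 2π + max(|log c|,|log a|))∕2 + cJ)·|T₁^{(k)}|` — the B20 input.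
[cite: Balaban1985UV3, (65) p.273] -/
theorem abs_logZT_piecesAC_le_of_row (k : ℕ) {c a cn cJ : ℝ} (hc : 0 < c) (hrow : LogZTExtensiveAsCited (piecesAC 𝔎 X 𝔖 k) c a cn cJ) :
    |(𝔖 k).JT + StepSeries.gaussLog (𝔖 k).QT| ≤ (cn * ((Real.log (2 * Real.pi) + max |Real.log c| |Real.log a|) / 2) + cJ) * S.sites k :=
  hrow.logZT_le hc

/-- What the `norm35` row GIVES BACK at the carrier (`0 < c`): the leaf (35)_k with constant `cv·(log 2π + max(|log c|,|log a|))∕2 + cJ` — the C8 input.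
[cite: Balaban1985UV3, (35) p.265] -/
theorem norm35_piecesAC_of_row' (k : ℕ) {c a cv cJ : ℝ} (hc : 0 < c) (hrow : Norm35StepAsCited (piecesAC 𝔎 X 𝔖 k) c a cv cJ) :
    ∀ hh : Hist S.P (k + 1), |(𝔖 k).J1 hh + StepSeries.gaussLog ((𝔖 k).Q1 hh) - ((𝔖 k).JT + StepSeries.gaussLog (𝔖 k).QT)|
      ≤ (cv * ((Real.log (2 * Real.pi) + max |Real.log c| |Real.log a|) / 2) + cJ) * (piecesAC 𝔎 X 𝔖 k).Zvol hh :=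
  hrow.norm35 hc

end Carrier

end Summit.QuantumFields.YangMills.Theorems.AlphaInputsT3ACNorm35LogZTRowsOfLeaves

end
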